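import Literature.AnabelianGeometry.SemiGraphs.TemperedOrigin
import Literature.AnabelianGeometry.EtaleTheta.SettingCompletion
import Literature.AnabelianGeometry.EtaleTheta.GalSectDeltaXTransport

/-!
# [SemiAnbd] §6: transport of `Δ^temp` along an isomorphism of tempered groups — `α(Δ^temp_X) = Δ^temp_Y` from the profinite input

Mochizuki, *Semi-graphs of anabelioids*, Publ. RIMS **42** (2006) [SemiAnbd], §6, kurims p. 69
("natural injections `Π^temp_{X_K} ↪ Π_{X_K}`, `Δ^temp_X ↪ Δ_X`"), Thm. 6.5 (iii) p. 72, Thm. 6.6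
p. 72, Thm. 6.8 (ii)(iii) pp. 74–75: every one of these statements is about an ARBITRARY isomorphism
of tempered groups `α : Π^temp_{X_K} ⥲ Π^temp_{Y_L}`, and every kernel-explicit reduction of them in
the tree (`isoInducesDLocEquivalence_of_thm65iii`, `Thm68Sub.isoPreservesTemperedDLocType_of`,
`Thm68Sub.isoPreservesTorsionDecomp_of`, `Thm68Sub.mulNSubgroupTransport_holds`, …) takes the input
(hΔ) `α(Δ^temp_X) = Δ^temp_Y`, on which print is silent in §6 and which [EtTh] p. 24 attributes to
"[Mzk2], Lemma 1.3.8" (the PROFINITE statement "`Δ ⊆ Π` is group-theoretic", [AbsAnab] Lem. 1.1.4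
(i) / Lem. 1.3.8; the tree's named fact F-0007 `FundamentalExtension.PreservesGeom`).
[cite: MochizukiSemiAnbd2006, §6 p.69] [cite: MochizukiAbsAnab2004, Lemma 1.3.8 p.18]

This PROOF-ONLY file (cell abc-iut, L-F pack D [SemiAnbd] §6, seat abc-iut-L3-t12 gen 4; piece (a)
of the Thm. 6.5 (iii) reduction per abc-iut-f-174 / L3 lead β3; 0 `def`s, no new `Prop` fact) is the
`TemperedCurve`-level (two-curve) twin of abc-iut-w5-d062's `ThetaSetting`-only
`GalSectDeltaXTransport.lean`, for consumption BY NAME by the Thm. 6.5 (iii) / Thm. 6.8 closers: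

* `TemperedCurve.map_deltaTemp_eq_of_map_deltaHat_iso` — tempered from profinite: if a completed
  isomorphism `α̂` (`α̂ ∘ ι_X = ι_Y ∘ α`; one exists, `TemperedCurve.exists_isoCompletion`) maps `Δ_X`
  onto `Δ_Y`, then `α(Δ^temp_X) = Δ^temp_Y` (`Π^temp ∩ Δ = Δ^temp`, L2's `SettingCompletion.comap_deltaHat`);
* `TemperedCurve.map_deltaHat_eq_of_map_deltaTemp_iso` — profinite from tempered (closure of a dense
  image under a homeomorphism), and the resulting `iff`;
* `TemperedCurve.map_deltaTemp_eq_of_forall_map_deltaHat` — (hΔ) for EVERY `α` from the profinite law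
  "every isomorphism `Π_{X_K} ⥲ Π_{Y_L}` carries `Δ_X` onto `Δ_Y`" ([AbsAnab] Lem. 1.1.4 (i) shape);
* `TemperedCurve.map_deltaTemp_eq_of_preservesGeom_iso` — (hΔ) BY NAME from F-0007
  `FundamentalExtension.PreservesGeom` bound at fundamental extensions modelling `Π_{X_K} ↠ G_K`,
  `Π_{Y_L} ↠ G_L` and a completed isomorphism;
* `TemperedOrigin.map_deltaTemp_eq_of_hatLaw` — the origin-quantified packaging: ONE law binder
  (the profinite `Δ̂`-law at certified pairs) gives (hΔ) at every certified pair and every `α`.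

HONEST FRAMING: the profinite statement enters BY NAME (a hypothesis / the FACT F-0007); nothing
printed is asserted; typed ≠ proved; no side taken on [IUTchIII] Cor. 3.12, on which nothing here bears.
-/

noncomputable section

namespace Literature.AnabelianGeometry.SemiGraphs

open Literature.AnabelianGeometry.AbsoluteAnabelian
open Literature.AnabelianGeometry.EtaleTheta

namespace TemperedCurve

variable {p : ℕ} [Fact p.Prime] (X Y : TemperedCurve p) (α : X.PiTemp ≃ₜ* Y.PiTemp)

/-- Membership form of `Π^temp ∩ Δ = Δ^temp` (L2's `SettingCompletion.comap_deltaHat`): an element of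
`Π^temp_{X_K}` lies in `Δ^temp_X` iff its image in `Π_{X_K}` lies in `Δ_X`.
[cite: MochizukiSemiAnbd2006, §6 p.69] -/
theorem mem_deltaTemp_iff_toHat_mem_deltaHat (x : X.PiTemp) :
    x ∈ X.DeltaTemp ↔ X.toHat x ∈ X.DeltaHat := by
  rw [← SettingCompletion.comap_deltaHat X, Subgroup.mem_comap]
  rfl

/-- **Tempered from profinite**: if a completed isomorphism `α̂ : Π_{X_K} ⥲ Π_{Y_L}` of `α`
(`α̂ ∘ ι_X = ι_Y ∘ α`) carries `Δ_X` onto `Δ_Y`, then `α` carries `Δ^temp_X` onto `Δ^temp_Y`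
(because `Δ^temp = Π^temp ∩ Δ` on both sides). The `TemperedCurve`-level twin of
`ThetaSetting.map_deltaTemp_eq_of_map_deltaHat_isoCompletion`. [cite: MochizukiSemiAnbd2006, §6 p.69] -/
theorem map_deltaTemp_eq_of_map_deltaHat_iso (Φ : X.PiHat ≃ₜ* Y.PiHat)
    (hΦ : ∀ x : X.PiTemp, Φ (X.toHat x) = Y.toHat (α x))
    (hΔhat : X.DeltaHat.map Φ.toMulEquiv.toMonoidHom = Y.DeltaHat) :
    X.DeltaTemp.map α.toMulEquiv.toMonoidHom = Y.DeltaTemp := by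
  have hiff : ∀ x : X.PiTemp, x ∈ X.DeltaTemp ↔ α x ∈ Y.DeltaTemp := fun x => by
    rw [X.mem_deltaTemp_iff_toHat_mem_deltaHat, Y.mem_deltaTemp_iff_toHat_mem_deltaHat, ← hΦ x,
      ← hΔhat]
    constructor
    · intro hx
      exact ⟨X.toHat x, hx, rfl⟩
    · rintro ⟨y, hy, hyx⟩
      have : y = X.toHat x := Φ.injective hyx
      rwa [this] at hy
  ext y
  constructor
  · rintro ⟨x, hx, rfl⟩
    exact (hiff x).1 hx
  · intro hy
    refine ⟨α.symm y, (hiff _).2 ?_, α.apply_symm_apply y⟩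
    rwa [α.apply_symm_apply]

/-- **Profinite from tempered**: if `α` carries `Δ^temp_X` onto `Δ^temp_Y`, then any completed
isomorphism `α̂` of `α` carries `Δ_X` (the closure of the image of `Δ^temp_X`) onto `Δ_Y` — a
homeomorphism commutes with closures. [cite: MochizukiSemiAnbd2006, §6 p.69] -/
theorem map_deltaHat_eq_of_map_deltaTemp_iso (Φ : X.PiHat ≃ₜ* Y.PiHat)
    (hΦ : ∀ x : X.PiTemp, Φ (X.toHat x) = Y.toHat (α x))
    (hΔ : X.DeltaTemp.map α.toMulEquiv.toMonoidHom = Y.DeltaTemp) :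
    X.DeltaHat.map Φ.toMulEquiv.toMonoidHom = Y.DeltaHat := by
  -- the images of `Δ^temp` in the completions correspond under `Φ`
  have himg : (X.DeltaTemp.map X.toHat.toMonoidHom).map Φ.toMulEquiv.toMonoidHom =
      Y.DeltaTemp.map Y.toHat.toMonoidHom := by
    rw [← hΔ, Subgroup.map_map, Subgroup.map_map]
    apply le_antisymm
    · rintro _ ⟨x, hx, rfl⟩
      exact ⟨x, hx, (hΦ x).symm⟩
    · rintro _ ⟨x, hx, rfl⟩
      exact ⟨x, hx, hΦ x⟩
  -- closures: `Φ` is a homeomorphism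
  apply SetLike.coe_injective
  change Φ '' closure ((X.DeltaTemp.map X.toHat.toMonoidHom : Subgroup X.PiHat) : Set X.PiHat) =
    closure ((Y.DeltaTemp.map Y.toHat.toMonoidHom : Subgroup Y.PiHat) : Set Y.PiHat)
  rw [show (Φ : X.PiHat → Y.PiHat) = Φ.toHomeomorph from rfl, Φ.toHomeomorph.image_closure]
  congr 1
  have := congrArg (fun H : Subgroup Y.PiHat => (H : Set Y.PiHat)) himg
  simp only [Subgroup.coe_map] at this
  exact this

/-- `α(Δ^temp_X) = Δ^temp_Y` iff `α̂(Δ_X) = Δ_Y`, for any completed isomorphism `α̂` of `α`.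
[cite: MochizukiSemiAnbd2006, §6 p.69] -/
theorem map_deltaTemp_eq_iff_map_deltaHat_eq (Φ : X.PiHat ≃ₜ* Y.PiHat)
    (hΦ : ∀ x : X.PiTemp, Φ (X.toHat x) = Y.toHat (α x)) :
    X.DeltaTemp.map α.toMulEquiv.toMonoidHom = Y.DeltaTemp ↔
      X.DeltaHat.map Φ.toMulEquiv.toMonoidHom = Y.DeltaHat :=
  ⟨X.map_deltaHat_eq_of_map_deltaTemp_iso Y α Φ hΦ, X.map_deltaTemp_eq_of_map_deltaHat_iso Y α Φ hΦ⟩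

/-- **(hΔ) for every `α` from the profinite law** "every isomorphism of profinite groups
`Π_{X_K} ⥲ Π_{Y_L}` carries `Δ_X` onto `Δ_Y`" ([AbsAnab] Lem. 1.1.4 (i) / Lem. 1.3.8 shape, taken as a
hypothesis): a completed isomorphism of `α` exists (`exists_isoCompletion`), and the previous lemma
applies. [cite: MochizukiAbsAnab2004, Lemma 1.3.8 p.18] -/
theorem map_deltaTemp_eq_of_forall_map_deltaHat
    (hlaw : ∀ Φ : X.PiHat ≃ₜ* Y.PiHat, X.DeltaHat.map Φ.toMulEquiv.toMonoidHom = Y.DeltaHat) :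
    X.DeltaTemp.map α.toMulEquiv.toMonoidHom = Y.DeltaTemp := by
  obtain ⟨Φ, hΦ⟩ := X.exists_isoCompletion Y α
  exact X.map_deltaTemp_eq_of_map_deltaHat_iso Y α Φ hΦ (hlaw Φ)

/-- **(hΔ) BY NAME from F-0007** ([AbsAnab] Lem. 1.3.8 "`Δ ⊆ Π` is group-theoretic", the tree's
`FundamentalExtension.PreservesGeom`): bind it at fundamental extensions `(E, e_X)`, `(F, e_Y)`
modelling `Π_{X_K} ↠ G_K`, `Π_{Y_L} ↠ G_L` (isomorphisms of profinite groups carrying `Ker` onto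
`Δ_X`, `Δ_Y`) and at a completed isomorphism `α̂` of `α`; then `α(Δ^temp_X) = Δ^temp_Y`.  The
`TemperedCurve`-level twin of `ThetaSetting.map_deltaTemp_eq_of_preservesGeom_iso`.
[cite: MochizukiAbsAnab2004, Lemma 1.3.8 p.18] -/
theorem map_deltaTemp_eq_of_preservesGeom_iso (Φ : X.PiHat ≃ₜ* Y.PiHat)
    (hΦ : ∀ x : X.PiTemp, Φ (X.toHat x) = Y.toHat (α x)) (E F : FundamentalExtension.{0})
    (eX : E.arith ≃ₜ* X.PiHat) (eY : F.arith ≃ₜ* Y.PiHat)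
    (heX : E.geom.map eX.toMulEquiv.toMonoidHom = X.DeltaHat)
    (heY : F.geom.map eY.toMulEquiv.toMonoidHom = Y.DeltaHat)
    (h138 : FundamentalExtension.PreservesGeom (F := F) (eX.trans (Φ.trans eY.symm))) :
    X.DeltaTemp.map α.toMulEquiv.toMonoidHom = Y.DeltaTemp := by
  apply X.map_deltaTemp_eq_of_map_deltaHat_iso Y α Φ hΦ
  have h := congrArg (Subgroup.map eY.toMulEquiv.toMonoidHom) h138
  rw [heY, Subgroup.map_map] at h
  have hcomp : eY.toMulEquiv.toMonoidHom.comp (eX.trans (Φ.trans eY.symm)).toMulEquiv.toMonoidHom =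
      Φ.toMulEquiv.toMonoidHom.comp eX.toMulEquiv.toMonoidHom := by
    ext x
    change eY (eY.symm (Φ (eX x))) = Φ (eX x)
    rw [ContinuousMulEquiv.apply_symm_apply]
  rw [hcomp, ← Subgroup.map_map, heX] at h
  exact h

/-- The symmetric statement for `α⁻¹` follows from the one for `α` (bookkeeping used by the two-sided
closers, e.g. `Thm68Sub.isoPreservesTorsionDecomp_of`). [cite: MochizukiSemiAnbd2006, §6 p.69] -/
theorem map_deltaTemp_symm_eq_of_map_deltaTemp_eq
    (hΔ : X.DeltaTemp.map α.toMulEquiv.toMonoidHom = Y.DeltaTemp) :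
    Y.DeltaTemp.map α.symm.toMulEquiv.toMonoidHom = X.DeltaTemp := by
  rw [← hΔ, Subgroup.map_map]
  conv_rhs => rw [← Subgroup.map_id X.DeltaTemp]
  congr 1
  ext x
  exact α.symm_apply_apply x

end TemperedCurve

/-! ### Origin-quantified packaging: ONE law binder for all the §6 closers -/

namespace TemperedOrigin

variable {p : ℕ} [Fact p.Prime]

/-- **(hΔ) at every certified pair and every `α`, from the profinite `Δ̂`-law at certified pairs**:
if for all hyperbolic curves `X_K`, `Y_L` over finite extensions of `ℚ_p` (certified by `Ω`) every
isomorphism of profinite groups `Π_{X_K} ⥲ Π_{Y_L}` carries `Δ_X` onto `Δ_Y` ([AbsAnab] Lem. 1.1.4 (i)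
/ Lem. 1.3.8 — a hypothesis, the FACT F-0007 in `TemperedCurve` currency), then every isomorphism of
tempered groups `α : Π^temp_{X_K} ⥲ Π^temp_{Y_L}` carries `Δ^temp_X` onto `Δ^temp_Y` — the (hΔ)
binder of the Thm. 6.5 (iii) / Thm. 6.8 (ii)(iii) closers. [cite: MochizukiAbsAnab2004, Lemma 1.3.8 p.18] -/
theorem map_deltaTemp_eq_of_hatLaw (Ω : TemperedOrigin p)
    (hhat : ∀ X Y : TemperedCurve p, Ω.IsHyperbolicCurveOrigin X → Ω.IsHyperbolicCurveOrigin Y →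
      ∀ Φ : X.PiHat ≃ₜ* Y.PiHat, X.DeltaHat.map Φ.toMulEquiv.toMonoidHom = Y.DeltaHat)
    (X Y : TemperedCurve p) (hX : Ω.IsHyperbolicCurveOrigin X) (hY : Ω.IsHyperbolicCurveOrigin Y)
    (α : X.PiTemp ≃ₜ* Y.PiTemp) :
    X.DeltaTemp.map α.toMulEquiv.toMonoidHom = Y.DeltaTemp :=
  X.map_deltaTemp_eq_of_forall_map_deltaHat Y α (hhat X Y hX hY)

/-- Conversely the tempered law at certified pairs gives back the profinite law at certified pairs for
those `Φ` that complete some tempered isomorphism — in particular (Thm. 6.6, `ProfiniteOuterIsoLifts`: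
every `Φ` is, up to an inner automorphism of `Π_{Y_L}`, such a completion) the two laws carry the same
content at certified data.  Recorded for `Φ = α̂` only (no Thm. 6.6 input).
[cite: MochizukiSemiAnbd2006, Thm 6.6 p.72] -/
theorem map_deltaHat_eq_of_tempLaw (Ω : TemperedOrigin p)
    (htemp : ∀ X Y : TemperedCurve p, Ω.IsHyperbolicCurveOrigin X → Ω.IsHyperbolicCurveOrigin Y →
      ∀ α : X.PiTemp ≃ₜ* Y.PiTemp, X.DeltaTemp.map α.toMulEquiv.toMonoidHom = Y.DeltaTemp)
    (X Y : TemperedCurve p) (hX : Ω.IsHyperbolicCurveOrigin X) (hY : Ω.IsHyperbolicCurveOrigin Y)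
    (α : X.PiTemp ≃ₜ* Y.PiTemp) (Φ : X.PiHat ≃ₜ* Y.PiHat)
    (hΦ : ∀ x : X.PiTemp, Φ (X.toHat x) = Y.toHat (α x)) :
    X.DeltaHat.map Φ.toMulEquiv.toMonoidHom = Y.DeltaHat :=
  X.map_deltaHat_eq_of_map_deltaTemp_iso Y α Φ hΦ (htemp X Y hX hY α)

end TemperedOrigin

end Literature.AnabelianGeometry.SemiGraphs

end
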